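import Mathlib.Algebra.BigOperators.Group.Finset.Sigma
import Mathlib.Algebra.Group.Basic
import Mathlib.Data.Finset.Card
import Mathlib.Data.Fintype.Card
import Mathlib.Data.Fintype.Sigma
import Mathlib.Data.Fintype.Prod
import Mathlib.Data.Fintype.BigOperators
import HarnessLib

/-!
# The triple product property and the simultaneous triple product property

Topic: `Literature/Combinatorics/Additive`. Work item `defn-TripleProductProperty` (wanted by the
`MatrixMultiplication` route `GroupTheoreticSTPP`, statements 0593/0595/0597).

The two combinatorial conditions on subsets of a group underlying the Cohn–Umans group-theoretic
approach to fast matrix multiplication, as *named predicates* on `Finset`s of a `Group`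
(multiplicative) and, via `to_additive`, of an `AddGroup`:

* `TripleProductProperty S T U` / `AddTripleProductProperty S T U` — Cohn–Umans 2003, Def. 2.1
  (= Cohn–Kleinberg–Szegedy–Umans 2005, Def. 1.3): with the right quotient sets
  `Q(S) = {s s'⁻¹ : s, s' ∈ S}`, "for `qᵢ ∈ Q(Sᵢ)`, if `q₁ q₂ q₃ = 1` then `q₁ = q₂ = q₃ = 1`",
  spelled out element-wise: `s s'⁻¹ (t t'⁻¹) (u u'⁻¹) = 1 → s = s' ∧ t = t' ∧ u = u'`.
* `SimultaneousTPP A B C` / `AddSimultaneousTPP A B C` for a family of triples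
  `(A i, B i, C i)_{i : ι}` — CKSU 2005, Def. 5.1, verbatim (two clauses): each triple has the
  triple product property, and
  `aᵢ a'ⱼ⁻¹ bⱼ b'ₖ⁻¹ cₖ c'ᵢ⁻¹ = 1 ⟹ i = j = k` for `aᵢ ∈ Aᵢ, a'ⱼ ∈ Aⱼ, bⱼ ∈ Bⱼ, b'ₖ ∈ Bₖ,
  cₖ ∈ Cₖ, c'ᵢ ∈ Cᵢ`.

API (all proved):

* `TripleProductProperty.mono` — subsets of a TPP triple form a TPP triple;
* `SimultaneousTPP.tripleProductProperty` — projection to the first clause;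
* `simultaneousTPP_iff_forall` (commutative groups) — CKSU Def. 5.1 is equivalent to the one-clause
  form of Blasiak–Church–Cohn–Grochow–Naslund–Sawin–Umans 2017, Def. 2.2 ("Equivalently, … for all
  `i, j, k` and `s ∈ A_k, s' ∈ A_i, t ∈ B_i, t' ∈ B_j, u ∈ C_j, u' ∈ C_k`, we have
  `s⁻¹s' t⁻¹t' u⁻¹u' = 1 ⟺ i = j = k, s = s', t = t', u = u'`"); its additive translation
  `addSimultaneousTPP_iff_forall` has as right-hand side *literally* the predicate inlined in the
  route statement `CThesis` (stmt-MatrixMultiplication-0593) and named `Literature.Computability.AlgebraicComplexity.IsSTPP` in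
  `Literature/Computability/AlgebraicComplexity/GroupTheoreticMatMul.lean` (so
  `AddSimultaneousTPP A B C ↔ IsSTPP A B C` is `addSimultaneousTPP_iff_forall A B C` followed by
  `Iff.rfl`; that file is not imported here to keep this one free of complexity theory).
* `SimultaneousTPP.sum_card_mul_card_le` — the first *packing bound* of BCCGNSU 2017, §2
  (display before Def. 2.3): `∑ᵢ |Aᵢ| |Bᵢ| ≤ |H|`, for any group, under the (implicit in print)
  hypothesis that every `Cᵢ` is nonempty.

Related tree declarations (not duplicated here): `Literature.CplxAlg.RealizesTPP G n m p`
(`CohnUmansTPP.lean`) unfolds by `Iff.rfl` to `∃ S T U, |S| = n ∧ |T| = m ∧ |U| = p ∧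
TripleProductProperty S T U`; the named facts CKSU 2005 Thm. 1.8 / Cor. 1.9 (`CKSU2005_thm18`,
`CKSU2005_cor19`, same file) and Thm. 5.5, abelian case (`CohnKleinbergSzegedyUmans2005_5_5_abelian`,
`GroupTheoreticMatMul.lean`) are already vendored there.

## References (statements verified by `lit read`)

* H. Cohn, C. Umans, *A group-theoretic approach to fast matrix multiplication*, FOCS 2003,
  arXiv:math/0307321, Def. 2.1 (p. 4 of the arXiv version: "A group `G` realizes `⟨n₁, n₂, n₃⟩` if
  there are subsets `S₁, S₂, S₃ ⊆ G` such that `|Sᵢ| = nᵢ`, and for `qᵢ ∈ Q(Sᵢ)`, if `q₁q₂q₃ = 1` then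
  `q₁ = q₂ = q₃ = 1`. We call this condition on `S₁, S₂, S₃` the triple product property.").
* H. Cohn, R. Kleinberg, B. Szegedy, C. Umans, *Group-theoretic algorithms for matrix
  multiplication*, FOCS 2005, arXiv:math/0511460, Def. 1.3 (p. 4), Def. 5.1 (pp. 8–9, quoted in the
  docstring of `SimultaneousTPP`; "In most applications the group `H` will be abelian, in which case
  it is more conventional to use additive notation. In this notation the implication above becomes
  `aᵢ − a'ⱼ + bⱼ − b'ₖ + cₖ − c'ᵢ = 0` implies `i = j = k`.").
* J. Blasiak, T. Church, H. Cohn, J. A. Grochow, E. Naslund, W. F. Sawin, C. Umans, *On cap sets and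
  the group-theoretic approach to matrix multiplication*, Discrete Analysis 2017:3, arXiv:1605.06702,
  Def. 2.2 and the packing bounds `∑ᵢ |Aᵢ||Bᵢ| ≤ |H|`, `∑ᵢ |Bᵢ||Cᵢ| ≤ |H|`, `∑ᵢ |Cᵢ||Aᵢ| ≤ |H|`
  (pp. 4–5).

## Design notes

* `Finset`s (not `Set`s): every requester counts elements, and with `Finset` binders the predicates
  unfold *syntactically* to the forms inlined in the route statements (`CThesis`,
  `CAbelianObstructionNeg`, `CNonabelianTPPFamilies`).
* The index type `ι` of a family is arbitrary (the routes use `Fin N`); no finiteness or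
  decidability is needed to state the property.
* CKSU Def. 5.1 and the "equivalently" clause of BCCGNSU Def. 2.2 place the inverses differently
  (`a a'⁻¹ b b'⁻¹ c c'⁻¹` versus `s⁻¹s' t⁻¹t' u⁻¹u'`); they agree in abelian groups
  (`simultaneousTPP_iff_forall`), which is the only setting in which BCCGNSU use it. We vendor the
  CKSU form as the definition since it is the original and is stated for arbitrary groups.
* The additive translations (`to_additive`) carry the same references as their multiplicative
  sources; they are spelled out in prose in the `to_additive` docstrings (a bracketed tag inside an
  attribute docstring is not parsed by the gate).
* The packing bound needs `Cᵢ ≠ ∅` for all `i` (with some `Cᵢ = ∅` the second clause says nothing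
  about `Aᵢ⁻¹Bᵢ` versus `Aⱼ⁻¹Bⱼ`; e.g. `A₁ = B₁ = H`, `C₁ = ∅` is an STPP family with
  `|A₁||B₁| = |H|² > |H|`); the source leaves this implicit (an empty `Cᵢ` contributes `0` to
  `∑ (|Aᵢ||Bᵢ||Cᵢ|)^{ω/3}` and is never considered).
-/

open scoped BigOperators
open Finset

namespace Literature.Combinatorics.Additive

universe u v

variable {G : Type u} [Group G]

/-! ## The triple product property -/

/-- **Triple product property** of three finite subsets `S, T, U` of a group `G` (Cohn–Umans 2003,
Def. 2.1; Cohn–Kleinberg–Szegedy–Umans 2005, Def. 1.3): with `Q(S) = {s s'⁻¹ : s, s' ∈ S}` the right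
quotient set, "for `q₁ ∈ Q(S)`, `q₂ ∈ Q(T)`, `q₃ ∈ Q(U)`, if `q₁ q₂ q₃ = 1` then `q₁ = q₂ = q₃ = 1`",
i.e. `s s'⁻¹ · t t'⁻¹ · u u'⁻¹ = 1` forces `s = s'`, `t = t'`, `u = u'`. A group containing such a
triple *realizes* `⟨|S|, |T|, |U|⟩` (see `Literature.Computability.AlgebraicComplexity.RealizesTPP`).
[cite: CohnUmans2003, Def. 2.1] [cite: CohnKleinbergSzegedyUmans2005, Def. 1.3] -/
@[to_additive AddTripleProductProperty /-- **Triple product property**, additive notation, of three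
finite subsets `S, T, U` of an additive group `G` (Cohn–Umans 2003, Def. 2.1; Cohn–Kleinberg–Szegedy–
Umans 2005, Def. 1.3, written additively as in CKSU 2005 §5): `(s − s') + (t − t') + (u − u') = 0`
with `s, s' ∈ S`, `t, t' ∈ T`, `u, u' ∈ U` forces `s = s'`, `t = t'`, `u = u'`.
(References as for `TripleProductProperty`: CohnUmans2003, Def. 2.1; CohnKleinbergSzegedyUmans2005,
Def. 1.3.) -/]
def TripleProductProperty (S T U : Finset G) : Prop :=
  ∀ s ∈ S, ∀ s' ∈ S, ∀ t ∈ T, ∀ t' ∈ T, ∀ u ∈ U, ∀ u' ∈ U,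
    s * s'⁻¹ * (t * t'⁻¹) * (u * u'⁻¹) = 1 → s = s' ∧ t = t' ∧ u = u'

/-- Subsets of a triple with the triple product property again have it (immediate from the
definition: the condition is a universal statement over the three sets). [folklore] -/
@[to_additive /-- Subsets of a triple with the (additive) triple
product property again have it. [folklore] -/]
theorem TripleProductProperty.mono {S T U S' T' U' : Finset G} (h : TripleProductProperty S T U)
    (hS : S' ⊆ S) (hT : T' ⊆ T) (hU : U' ⊆ U) : TripleProductProperty S' T' U' :=
  fun s hs s' hs' t ht t' ht' u hu u' hu' =>
    h s (hS hs) s' (hS hs') t (hT ht) t' (hT ht') u (hU hu) u' (hU hu')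

/-! ## The simultaneous triple product property -/

/-- **Simultaneous triple product property** (STPP) of a family of triples `(A i, B i, C i)_{i : ι}`
of finite subsets of a group `H` (Cohn–Kleinberg–Szegedy–Umans 2005, Def. 5.1, verbatim: "We say that
`n` triples of subsets `Aᵢ, Bᵢ, Cᵢ` of a group `H` satisfy the *simultaneous triple product property*
if (i) for each `i`, the three subsets `Aᵢ, Bᵢ, Cᵢ` satisfy the triple product property, and (ii) for
all `i, j, k`, `aᵢ (a'ⱼ)⁻¹ bⱼ (b'ₖ)⁻¹ cₖ (c'ᵢ)⁻¹ = 1` implies `i = j = k` for `aᵢ ∈ Aᵢ`, `a'ⱼ ∈ Aⱼ`,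
`bⱼ ∈ Bⱼ`, `b'ₖ ∈ Bₖ`, `cₖ ∈ Cₖ` and `c'ᵢ ∈ Cᵢ`. We say that such a group *simultaneously realizes*
`⟨|A₁|,|B₁|,|C₁|⟩, …, ⟨|Aₙ|,|Bₙ|,|Cₙ|⟩`."; = Blasiak et al. 2017, Def. 2.2, "STPP construction").
For abelian groups see `simultaneousTPP_iff_forall` for the equivalent one-clause form.
[cite: CohnKleinbergSzegedyUmans2005, Def. 5.1]
[cite: BlasiakChurchCohnGrochowNaslundSawinUmans2017, Def. 2.2] -/
@[to_additive AddSimultaneousTPP /-- **Simultaneous triple product property** (STPP), additive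
notation, of a family of triples `(A i, B i, C i)_{i : ι}` of finite subsets of an additive group `H`
(Cohn–Kleinberg–Szegedy–Umans 2005, Def. 5.1: (i) each triple `Aᵢ, Bᵢ, Cᵢ` has the triple product
property, and (ii) "`aᵢ − a'ⱼ + bⱼ − b'ₖ + cₖ − c'ᵢ = 0` implies `i = j = k`" for `aᵢ ∈ Aᵢ`,
`a'ⱼ ∈ Aⱼ`, `bⱼ ∈ Bⱼ`, `b'ₖ ∈ Bₖ`, `cₖ ∈ Cₖ`, `c'ᵢ ∈ Cᵢ`; = Blasiak et al. 2017, Def. 2.2). For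
abelian groups `addSimultaneousTPP_iff_forall` gives the equivalent one-clause form, which is the
tree's `Literature.Computability.AlgebraicComplexity.IsSTPP`. (References as for `SimultaneousTPP`: CohnKleinbergSzegedyUmans2005,
Def. 5.1; BlasiakChurchCohnGrochowNaslundSawinUmans2017, Def. 2.2.) -/]
def SimultaneousTPP {ι : Type v} (A B C : ι → Finset G) : Prop :=
  (∀ i, TripleProductProperty (A i) (B i) (C i)) ∧
    ∀ i j k, ∀ a ∈ A i, ∀ a' ∈ A j, ∀ b ∈ B j, ∀ b' ∈ B k, ∀ c ∈ C k, ∀ c' ∈ C i,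
      a * a'⁻¹ * b * b'⁻¹ * c * c'⁻¹ = 1 → i = j ∧ j = k

/-- Each triple of an STPP family has the triple product property (clause (i) of CKSU Def. 5.1).
[cite: CohnKleinbergSzegedyUmans2005, Def. 5.1] -/
@[to_additive AddSimultaneousTPP.addTripleProductProperty /-- Each triple of an (additive) STPP
family has the triple product property (clause (i) of CKSU Def. 5.1).
(Reference as for the multiplicative version: CohnKleinbergSzegedyUmans2005, Def. 5.1.) -/]
theorem SimultaneousTPP.tripleProductProperty {ι : Type v} {A B C : ι → Finset G}
    (h : SimultaneousTPP A B C) (i : ι) : TripleProductProperty (A i) (B i) (C i) :=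
  h.1 i

section packing

variable {ι : Type v} [Fintype ι] [Fintype G] [DecidableEq G] {A B C : ι → Finset G}

/-- **Packing bound** (Blasiak–Church–Cohn–Grochow–Naslund–Sawin–Umans 2017, §2, before Def. 2.3:
"Any STPP construction satisfies some simple 'packing bound' inequalities, which reflect the fact
that the sets `Sᵢ` must be disjoint from each other … since the sets `Aᵢ, Bᵢ, Cᵢ` satisfy the triple
product property we must have `|Sᵢ| = |Aᵢ||Bᵢ|` … `∑ᵢ |Aᵢ||Bᵢ| ≤ |H|`"). Precisely: if every `Cᵢ` is
nonempty, the map `(i, a, b) ↦ a⁻¹ b` on `⨆ᵢ Aᵢ × Bᵢ` is injective, so `∑ᵢ |Aᵢ| |Bᵢ| ≤ |H|`; valid in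
every finite group. (The nonemptiness hypothesis is implicit in the source; without it the bound
fails, see the module docstring.) [cite: BlasiakChurchCohnGrochowNaslundSawinUmans2017, §2] -/
@[to_additive AddSimultaneousTPP.sum_card_mul_card_le /-- **Packing bound**, additive notation
(Blasiak et al. 2017, §2, before Def. 2.3): for an STPP family in a finite additive group `H` with all
`Cᵢ` nonempty, `(i, a, b) ↦ -a + b` is injective on `⨆ᵢ Aᵢ × Bᵢ`, so `∑ᵢ |Aᵢ| |Bᵢ| ≤ |H|`.
(Reference as for the multiplicative version: BlasiakChurchCohnGrochowNaslundSawinUmans2017, §2.) -/]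
theorem SimultaneousTPP.sum_card_mul_card_le (h : SimultaneousTPP A B C)
    (hC : ∀ i, (C i).Nonempty) : ∑ i, (A i).card * (B i).card ≤ Fintype.card G := by
  classical
  set D : Finset (Σ _ : ι, G × G) := Finset.univ.sigma fun i => A i ×ˢ B i with hD
  have hinj : Set.InjOn (fun x : (Σ _ : ι, G × G) => x.2.1⁻¹ * x.2.2) ↑D := by
    rintro ⟨i, a, b⟩ hx ⟨j, a', b'⟩ hy (he : a⁻¹ * b = a'⁻¹ * b')
    simp only [hD, Finset.coe_sigma, Set.mem_sigma_iff, Finset.coe_univ, Set.mem_univ, true_and,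
      Finset.coe_product, Set.mem_prod, Finset.mem_coe] at hx hy
    obtain ⟨c, hc⟩ := hC j
    -- the six-fold product of clause (ii) with indices `(j, i, j)` collapses to `1`
    have key : a' * a⁻¹ * b * b'⁻¹ * c * c⁻¹ = 1 := by
      rw [mul_inv_cancel_right, mul_assoc a', he, mul_inv_cancel_left, mul_inv_cancel]
    obtain ⟨rfl, -⟩ := h.2 j i j a' hy.1 a hx.1 b hx.2 b' hy.2 c hc c hc key
    -- same index: the triple product property of `(A i, B i, C i)` gives `a = a'`, `b = b'`
    have key' : a' * a⁻¹ * (b * b'⁻¹) * (c * c⁻¹) = 1 := by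
      simpa only [mul_assoc] using key
    obtain ⟨h1, h2, -⟩ := h.1 _ a' hy.1 a hx.1 b hx.2 b' hy.2 c hc c hc key'
    subst h1 h2
    rfl
  calc ∑ i, (A i).card * (B i).card = D.card := by
        rw [hD, Finset.card_sigma]; simp only [Finset.card_product]
    _ = (D.image fun x : (Σ _ : ι, G × G) => x.2.1⁻¹ * x.2.2).card :=
        (Finset.card_image_of_injOn hinj).symm
    _ ≤ Fintype.card G := Finset.card_le_univ _

end packing

/-! ## Abelian groups: the one-clause form -/

section comm

variable {H : Type u} [CommGroup H] {ι : Type v}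

/-- In an abelian group, CKSU Def. 5.1 is equivalent to the one-clause form of Blasiak et al. 2017,
Def. 2.2 ("Equivalently, `Aᵢ, Bᵢ, Cᵢ ⊆ H` satisfy the STPP if for all `i, j, k` and `s ∈ A_k`,
`s' ∈ A_i`, `t ∈ B_i`, `t' ∈ B_j`, `u ∈ C_j`, and `u' ∈ C_k`, we have
`s⁻¹s' t⁻¹t' u⁻¹u' = 1 ⟺ i = j = k, s = s', t = t', u = u'`"; only `⟹` is content). The additive
translation's right-hand side is verbatim the STPP predicate inlined in the `MatrixMultiplication`
route statements (`Literature.Computability.AlgebraicComplexity.IsSTPP`). Proof: clause (ii) with indices `(k, i, j)` applied to the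
inverse of the given relation yields `i = j = k`, then clause (i) yields the equalities; conversely
specialise the one-clause form to `i = j = k`, resp. read off the index equalities.
[cite: BlasiakChurchCohnGrochowNaslundSawinUmans2017, Def. 2.2] -/
@[to_additive addSimultaneousTPP_iff_forall /-- In an additive abelian group, CKSU Def. 5.1 is
equivalent to the one-clause form of Blasiak et al. 2017, Def. 2.2, written additively: for all
`i j k`, `s ∈ A k`, `s' ∈ A i`, `t ∈ B i`, `t' ∈ B j`, `u ∈ C j`, `u' ∈ C k`,
`(s' − s) + (t' − t) + (u' − u) = 0 → i = j ∧ j = k ∧ s = s' ∧ t = t' ∧ u = u'`. The right-hand side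
is verbatim the predicate inlined in the route statement `CThesis` (stmt-MatrixMultiplication-0593)
and named `Literature.Computability.AlgebraicComplexity.IsSTPP` (so `AddSimultaneousTPP A B C ↔ IsSTPP A B C` by this lemma and
`Iff.rfl`). (Reference as for `simultaneousTPP_iff_forall`:
BlasiakChurchCohnGrochowNaslundSawinUmans2017, Def. 2.2.) -/]
theorem simultaneousTPP_iff_forall (A B C : ι → Finset H) :
    SimultaneousTPP A B C ↔
      ∀ i j k : ι, ∀ s ∈ A k, ∀ s' ∈ A i, ∀ t ∈ B i, ∀ t' ∈ B j, ∀ u ∈ C j, ∀ u' ∈ C k,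
        s' / s * (t' / t) * (u' / u) = 1 → i = j ∧ j = k ∧ s = s' ∧ t = t' ∧ u = u' := by
  -- the algebraic identity relating the two six-fold products
  have flip : ∀ a a' b b' c c' : H,
      a' / a * (b' / b) * (c' / c) = (a * a'⁻¹ * b * b'⁻¹ * c * c'⁻¹)⁻¹ := by
    intro a a' b b' c c'
    simp only [mul_inv_rev, inv_inv, div_eq_mul_inv]
    simp only [mul_comm, mul_left_comm, mul_assoc]
  have flip' : ∀ a a' b b' c c' : H,
      a * a'⁻¹ * (b * b'⁻¹) * (c * c'⁻¹) = a * a'⁻¹ * b * b'⁻¹ * c * c'⁻¹ := by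
    intro a a' b b' c c'
    simp only [mul_assoc]
  constructor
  · rintro ⟨hT, hX⟩ i j k s hs s' hs' t ht t' ht' u hu u' hu' he
    have he' : s * s'⁻¹ * t * t'⁻¹ * u * u'⁻¹ = 1 := by
      rw [← inv_eq_one, ← flip]; exact he
    obtain ⟨rfl, rfl⟩ := hX k i j s hs s' hs' t ht t' ht' u hu u' hu' he'
    exact ⟨rfl, rfl, hT k s hs s' hs' t ht t' ht' u hu u' hu' ((flip' _ _ _ _ _ _).trans he')⟩
  · intro hP
    refine ⟨fun i s hs s' hs' t ht t' ht' u hu u' hu' he => ?_,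
      fun i j k a ha a' ha' b hb b' hb' c hc c' hc' he => ?_⟩
    · have he' : s / s' * (t / t') * (u / u') = 1 := by
        simpa only [div_eq_mul_inv] using he
      obtain ⟨-, -, h1, h2, h3⟩ := hP i i i s' hs' s hs t' ht' t ht u' hu' u hu he'
      exact ⟨h1.symm, h2.symm, h3.symm⟩
    · have he' : a' / a * (b' / b) * (c' / c) = 1 := by
        rw [flip, he, inv_one]
      obtain ⟨h1, h2, -⟩ := hP j k i a ha a' ha' b hb b' hb' c hc c' hc' he'
      exact ⟨(h1.trans h2).symm, h1⟩

end comm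

/-! ## No room for a third set: quotients of two sets covering the group -/

/-- **No third set beside a covering pair.**  If the right quotients of `S` and `T` already cover the
group — every `g` is `s s'⁻¹ · t t'⁻¹` with `s, s' ∈ S`, `t, t' ∈ T` — then any `U` completing a triple
`(S, T, U)` with the triple product property has at most one element: for `u, u' ∈ U` write
`(u u'⁻¹)⁻¹ = s s'⁻¹ · t t'⁻¹`; then `s s'⁻¹ · t t'⁻¹ · u u'⁻¹ = 1` is a TPP relation, so `u = u'`.
In particular a pair `(S, T)` that factorises a finite group exactly (`|S| |T| = |G|`, every `g` some
`s⁻¹ t`, `1 ∈ S ∩ T`; e.g. complementary stabiliser-chain classes of `S_n`) extends to no TPP triple with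
`|U| ≥ 2` (`TripleProductProperty.card_le_one_of_inv_mul_cover`).  [folklore; immediate from
Cohn–Umans 2003, Def. 2.1] -/
@[to_additive /-- **No third set beside a covering pair**, additive notation: if every `g` is
`(s - s') + (t - t')` with `s, s' ∈ S`, `t, t' ∈ T`, then any `U` completing an (additive) TPP triple
`(S, T, U)` has at most one element. [folklore] -/]
theorem TripleProductProperty.card_le_one_of_quotients_cover {S T U : Finset G}
    (h : TripleProductProperty S T U)
    (hST : ∀ g : G, ∃ s ∈ S, ∃ s' ∈ S, ∃ t ∈ T, ∃ t' ∈ T, s * s'⁻¹ * (t * t'⁻¹) = g) :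
    U.card ≤ 1 := by
  refine Finset.card_le_one.2 fun u hu u' hu' => ?_
  obtain ⟨s, hs, s', hs', t, ht, t', ht', hg⟩ := hST (u * u'⁻¹)⁻¹
  exact (h s hs s' hs' t ht t' ht' u hu u' hu' (by rw [hg, inv_mul_cancel])).2.2

/-- **No third set beside an exact rooted pair.**  If `1 ∈ S`, `1 ∈ T` and the mixed quotients
`s⁻¹ t` (`s ∈ S`, `t ∈ T`) cover the group, then any `U` completing a TPP triple `(S, T, U)` has at
most one element (take `s = 1`, `t' = 1` in `TripleProductProperty.card_le_one_of_quotients_cover`).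
[folklore] -/
@[to_additive /-- **No third set beside an exact rooted pair**, additive notation: if `0 ∈ S`,
`0 ∈ T` and every `g` is `-s + t` with `s ∈ S`, `t ∈ T`, then any `U` completing an (additive) TPP
triple `(S, T, U)` has at most one element. [folklore] -/]
theorem TripleProductProperty.card_le_one_of_inv_mul_cover {S T U : Finset G}
    (h : TripleProductProperty S T U) (hS : (1 : G) ∈ S) (hT : (1 : G) ∈ T)
    (hST : ∀ g : G, ∃ s ∈ S, ∃ t ∈ T, s⁻¹ * t = g) : U.card ≤ 1 :=
  h.card_le_one_of_quotients_cover fun g =>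
    let ⟨s, hs, t, ht, hg⟩ := hST g
    ⟨1, hS, s, hs, t, ht, 1, hT, by rw [one_mul, inv_one, mul_one, hg]⟩

end Literature.Combinatorics.Additive
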